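import Summits.Schanuel.Schanuel.Theorems.RootDecomp1HPin

/-!
# RootDecomp1HPinTwist — part 2/2 of the port of lens-5 gen 15 «PIN» (Pin.lean 43a82e19…): §5 three TWIST31 systems (census/TWIST31-v1.md Table 3,
kit j340978) whose bridge instances (BridgeTransverse 30564 / BridgeTransverseSigma 26887) are VACUOUS by the binder-free hull pin of part 1.
Split off for the 400-line lint; namespace and texts verbatim. `--supports stmt-Schanuel-26887`. Sorry-free; standard axioms. Nothing here proves Schanuel; rung 0.
-/

set_option linter.dupNamespace false

noncomputable section

namespace Summit.Schanuel.Schanuel.Theorems.RootDecomp1HPin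


open Complex Set
open Literature.NumberTheory.Transcendental
open Summit.Schanuel.Schanuel.Theorems.RootDecomp1HTowerCells
open Summit.Schanuel.Schanuel.Theorems.RootDecomp1HCurveHull
open Summit.Schanuel.Schanuel.Theorems.RootDecomp1HHull
open Summit.Schanuel.Schanuel.Theorems.RootDecomp1HClearance

/-! ## 5. Ported instances: three TWIST31 systems (census/TWIST31-v1.md Table 3, kit j340978) whose bridge instances are vacuous
AT EVERY ZERO, by the pinning form they contain — kernel facts, no binder, valid for `BridgeTransverse` AND `BridgeTransverseSigma`. -/

/-- TWIST31 Table 3 row 10: system `{e^{y₁} − e^{y₂}, y₃ + e^{y₁} + e^{y₂} − 1, y₁ + y₂ + y₃ − e^{y₁} − e^{y₂} + e^{y₃}}` — the first form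
is the exp-binomial `expEq`. -/
theorem twist31_row10_bridge_vacuous {y : Fin 3 → ℂ} (h₁ : cexp (y 0) - cexp (y 1) = 0) (H₁ H₂ H₃ R : Prop) :
    H₁ → H₂ → H₃ → CounterEx y → ¬ InTowerHull y → R :=
  bridge_vacuous_of_expEq (i := 0) (j := 1) (by decide) (sub_eq_zero.mp h₁) H₁ H₂ H₃ R

/-- TWIST31 Table 3 row 0: system `{e^{y₁} + e^{y₂}, y₁ + y₂ − y₃ − e^{y₁} − e^{y₂} + e^{y₃} + 1, y₁ + y₂ − e^{y₁} − e^{y₂} + e^{y₃} − 1}` —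
the first form is the exp-binomial `expNeg`. -/
theorem twist31_row0_bridge_vacuous {y : Fin 3 → ℂ} (h₁ : cexp (y 0) + cexp (y 1) = 0) (H₁ H₂ H₃ R : Prop) :
    H₁ → H₂ → H₃ → CounterEx y → ¬ InTowerHull y → R :=
  bridge_vacuous_of_expNeg (i := 0) (j := 1) (eq_neg_of_add_eq_zero_left h₁) H₁ H₂ H₃ R

/-- TWIST31 Table 3 row 5: system `{−y₁ − y₂ − y₃ + e^{y₂} − e^{y₃} − 1, −y₁ − y₂ − y₃ + e^{y₁} − e^{y₃} − 1, y₃ − 1}` — the third form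
makes `y₃ = 1` (`ratCoord`). -/
theorem twist31_row5_bridge_vacuous {y : Fin 3 → ℂ} (h₃ : y 2 - 1 = 0) (H₁ H₂ H₃ R : Prop) :
    H₁ → H₂ → H₃ → CounterEx y → ¬ InTowerHull y → R :=
  bridge_vacuous_of_ratCoord (j := 2) (a := 1) (c := -1) one_ne_zero (by push_cast; linear_combination h₃) H₁ H₂ H₃ R

end Summit.Schanuel.Schanuel.Theorems.RootDecomp1HPin
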